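import Literature.AlgebraicGeometry.Villamayor2007.HElimAlgebraGenerators
import Literature.AlgebraicGeometry.Villamayor2007.IntegralOverH
import Literature.AlgebraicGeometry.Resolution.AdicNoetherian
import HarnessLib

/-!
# Villamayor 2007, Def. 1.42 (1.42.4) with Prop. 1.23 and 1.39, one monic polynomial: the elimination algebra
# `R̄_f ⊂ S[W]` is INTEGRAL over the computable algebra `ℋ_f = S[ψ_{Δ^e f, n}·W^{(b−n)(b−e)}]` — PROVED

O. E. Villamayor U., *Hypersurface singularities in positive characteristic*, Adv. Math. **213** (2007) 687–733
= arXiv:math/0606796 [Villamayor2007]: Prop. 1.23 p0010 L66–L96, 1.39–1.40 p0013 L96–L135, Def. 1.42 p0014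
L16–L64; A. Bravo, O. E. Villamayor U., Adv. Math. **224** (2010) 1349–1418 = arXiv:0807.4308 [BravoVillamayor2010]:
Paragraph 2.8 (2.8.1) p0025 L1–L19. Locators «p00NN Lnn» = chunk · line of the held arXiv texts (`lit read
paper:arxiv-math_0606796`, `lit read paper:arxiv-0807.4308`; p0010, p0013, p0014, BV p0025 re-read before typing).
Campaign `res-hironaka` (D-0089), ladder rung LIT-6. PROOF file: theorems only, NO definitions, NO named facts;
nothing of Hironaka's 2017 manuscript is referred to or asserted. Sequel of `IntegralOverH.lean` (Prop. 1.23 at the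
universal level: `R̄_b` is integral over `H_{F_b}`) and `HElimAlgebraGenerators.lean` ((1.42.3): `ℋ_f` = the weighted
coefficient algebra of the `ψ_{Δ^e f}`); one folklore graded-algebra lemma is imported from
`Resolution/AdicNoetherian.lean` (`homogeneousComponent_mul_of_isHomogeneous`).

## What is proved

* `exists_monic_graded_of_isIntegral` — **the graded form of an integral equation** (the mechanism of 1.39 p0013
  L100–L103 «if `G = Σ[G]_k ⊂ G' = Σ[G']_k` is a finite extension of ℕ-graded algebras, then `Σ[G]_k W^k ⊂
  Σ[G']_k W^k` is also finite»): a homogeneous `G ∈ k[Y]` of degree `r`, integral over `H_{F_b}`, satisfies a MONIC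
  equation `Q(G) = 0` whose coefficient of `X^i` lies in `H_{F_b}` and is homogeneous of degree `r·(deg Q − i)` —
  take the degree-`r·deg P` homogeneous component of any monic equation `P(G) = 0` (`H_{F_b}` is graded,
  `CharPolyGenerators.homogeneousComponent_mem_hSubalgebra`).
* `isIntegral_monomial_specialize` — for `G ∈ [R̄_b]_r` and `f = monicOf a`: the generator `G(a)·W^r` of
  `R̄_f = ⊕ I_r W^r` (§1.5 p0007 L65–L79) is integral over `ℋ_f`: the graded equation specializes (Def. 1.42 p0014
  L25–L40, the morphism `T[W] → S[W]`) to `(G(a)W^r)^m + Σ_{i<m} (c_i(a)W^{r(m−i)})·(G(a)W^r)^i = 0` with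
  `c_i(a)W^{r(m−i)} ∈ ℋ_f`.
* `isIntegral_of_mem_elimAlgebra`, `elimAlgebra_subset_integralClosure` — **(1.42.4)** p0014 L56–L60 «`ℋ_{f} ⊂
  R̄_{f}` and that this ring extension is finite», in the integral form: EVERY element of `R̄_f` (`elimAlgebra k a`)
  is integral over `ℋ_f` (`hElimAlgebra k a`). (Module-finiteness of `R̄_f` over `ℋ_f` would follow with finite
  generation of `R̄_b`, 1.11 / (1.25.2), which the tree does not prove; not claimed.)
* `isIntegral_mulCharpolyReesOfFamily_of_mem_elimAlgebra`, `elimAlgebra_subset_integralClosure_mulCharpolyReesOfFamily`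
  — combined with `HElimAlgebraGenerators.hElimAlgebra_eq_mulCharpolyReesOfFamily`: **`R̄_f` is integral over the
  COMPUTABLE algebra `S[ψ_{Δ^e f, n}·W^{(b−n)(b−e)} ; 1 ≤ e ≤ b − 1, n ≤ b]`** of weighted coefficients of the
  characteristic polynomials of multiplication by the Hasse derivatives `Δ^e(f)` on `S[Z]/⟨f⟩` — the one-polynomial
  case of Bravo–Villamayor 2010 Par. 2.8 p0025 L17–L19 «the elimination algebra … is generated by these coefficients up
  to integral closure», as a kernel theorem in the direction `R̄_f ⊆` (integral closure of the coefficient algebra).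
* NOT proved (named so that nobody assumes them): the converse (that `R̄_f` is integrally closed in `S[W]`, or equals
  that integral closure — print states normality only universally, Prop. 1.23 «`R̄_b` is THE integral closure of
  `H_{F_b}` in `k[s]`», whose `⊇` half is `IntegralOverH`, `⊆` half not in the tree); module-finiteness; the
  multi-polynomial algebras (Prop. 1.38). Scope: any commutative `k`, any commutative `k`-algebra `S`.

## References

* O. E. Villamayor U., Adv. Math. 213 (2007) 687–733 = arXiv:math/0606796: §1.5, Prop. 1.23, 1.39–1.40, Def. 1.42.
  [Villamayor2007]
* A. Bravo, O. E. Villamayor U., Adv. Math. 224 (2010) 1349–1418 = arXiv:0807.4308: Paragraph 2.8 (2.8.1).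
  [BravoVillamayor2010]
-/

noncomputable section

open scoped Polynomial

namespace Literature.AlgebraicGeometry.Villamayor2007

open MvPolynomial

universe u v w

/-! ## Universal level: a GRADED monic equation over `H_{F_b}` for a homogeneous integral element -/

section Graded

variable {ι : Type u} {k : Type v} [CommRing k] [Fintype ι]

/-- **Graded integral equations** (the mechanism behind 1.39 p0013 L100–L103 «if `G = Σ_k [G]_k ⊂ G' = Σ_k [G']_k` is
a finite extension of ℕ-graded algebras, then `Σ [G]_k W^k ⊂ Σ [G']_k W^k` is also finite» and Prop. 1.23 p0010
L66–L67 «`R̄_b` is the integral closure of the GRADED ring `H_{F_b}`»): if `G ∈ k[Y]` is homogeneous of degree `r` and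
integral over `H_{F_b}`, then `G` is a root of a monic `Q ∈ k[Y][X]` whose coefficient of `X^i` lies in `H_{F_b}` and
is homogeneous of degree `r·(deg Q − i)` — the degree-`r·deg P` component of any monic equation `P(G) = 0` over the
graded subalgebra `H_{F_b}`. [cite: Villamayor2007, 1.39 p0013 L96–L103] -/
theorem exists_monic_graded_of_isIntegral {G : MvPolynomial ι k} (hint : IsIntegral (hSubalgebra ι k) G)
    {r : ℕ} (hG : G.IsHomogeneous r) :
    ∃ Q : (MvPolynomial ι k)[X], Q.Monic ∧ (∀ i, Q.coeff i ∈ hSubalgebra ι k) ∧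
      (∀ i, (Q.coeff i).IsHomogeneous (r * (Q.natDegree - i))) ∧ Q.eval G = 0 := by
  rcases subsingleton_or_nontrivial k with hk | hk
  · refine ⟨Polynomial.X, Polynomial.monic_X, fun i => ?_, fun i => ?_, Subsingleton.elim _ _⟩
    · rw [Subsingleton.elim (Polynomial.X.coeff i) 0]; exact zero_mem _
    · rw [Subsingleton.elim (Polynomial.X.coeff i) 0]; exact isHomogeneous_zero _ _ _
  obtain ⟨p, hp, hpG⟩ := hint
  set P : (MvPolynomial ι k)[X] := p.map (algebraMap (hSubalgebra ι k) (MvPolynomial ι k)) with hPdef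
  have hP : P.Monic := hp.map _
  have hPG : P.eval G = 0 := by rw [hPdef, Polynomial.eval_map]; exact hpG
  have hPc : ∀ i, P.coeff i ∈ hSubalgebra ι k := fun i => by
    rw [hPdef, Polynomial.coeff_map]; exact (p.coeff i).2
  set m := P.natDegree with hm
  let Q : (MvPolynomial ι k)[X] :=
    ∑ i ∈ Finset.range (m + 1), Polynomial.monomial i (homogeneousComponent (r * (m - i)) (P.coeff i))
  have hQc : ∀ i, Q.coeff i = if i ≤ m then homogeneousComponent (r * (m - i)) (P.coeff i) else 0 := by
    intro i
    simp only [Q, Polynomial.finsetSum_coeff, Polynomial.coeff_monomial, Finset.sum_ite_eq',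
      Finset.mem_range, Nat.lt_succ_iff]
  have hQm : Q.coeff m = 1 := by
    rw [hQc, if_pos le_rfl, Nat.sub_self, mul_zero, hm, hP.coeff_natDegree, homogeneousComponent_zero,
      coeff_zero_one, map_one]
  have hQle : Q.natDegree ≤ m := by
    rw [Polynomial.natDegree_le_iff_coeff_eq_zero]
    intro N hN
    rw [hQc, if_neg (by omega)]
  have hQdeg : Q.natDegree = m :=
    Polynomial.natDegree_eq_of_le_of_coeff_ne_zero hQle (by rw [hQm]; exact one_ne_zero)
  have hQmonic : Q.Monic := by
    rw [Polynomial.Monic, Polynomial.leadingCoeff, hQdeg, hQm]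
  refine ⟨Q, hQmonic, fun i => ?_, fun i => ?_, ?_⟩
  · rw [hQc]
    split_ifs
    · exact homogeneousComponent_mem_hSubalgebra (hPc i) _
    · exact zero_mem _
  · rw [hQdeg, hQc]
    split_ifs
    · exact homogeneousComponent_isHomogeneous _ _
    · exact isHomogeneous_zero _ _ _
  · -- `Q(G)` is the degree-`r·m` component of `P(G) = 0`
    have h0 : homogeneousComponent (r * m) (P.eval G) = 0 := by rw [hPG, map_zero]
    rw [Polynomial.eval_eq_sum_range, hQdeg, ← h0, Polynomial.eval_eq_sum_range, map_sum]
    refine Finset.sum_congr rfl fun i hi => ?_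
    rw [Finset.mem_range, Nat.lt_succ_iff] at hi
    rw [hQc, if_pos hi, Literature.AlgebraicGeometry.Resolution.homogeneousComponent_mul_of_isHomogeneous
      (P.coeff i) (G ^ i) (r * m) (hG.pow i), if_pos (Nat.mul_le_mul_left r hi), ← mul_tsub]

end Graded

/-! ## (1.42.4): `R̄_f` is integral over `ℋ_f` -/

section Specialized

variable (k : Type v) [CommRing k] {S : Type w} [CommRing S] [Algebra k S] {b : ℕ}

/-- **The generators of `R̄_f` are integral over `ℋ_f`** [Villamayor 2007, Def. 1.42 (1.42.4) p0014 L56–L60 «`ℋ_{f} ⊂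
R̄_{f}` and that this ring extension is finite», with §1.5 p0007 L65–L79 (the generators `h·W^r`, `h = H(a)`, `H ∈
[R̄_b]_r`) and Prop. 1.23]: for `G ∈ [R̄_b]_r` and `f = monicOf a`, `G(a)·W^r ∈ S[W]` satisfies
`(G(a)W^r)^m + Σ_{i<m} (c_i(a)·W^{r(m−i)})·(G(a)W^r)^i = 0` with `c_i ∈ [H_{F_b}]_{r(m−i)}`, so `c_i(a)·W^{r(m−i)} ∈ ℋ_f`
— the specialization along `T[W] → S[W]` (Def. 1.42 p0014 L25–L40) of the graded equation of
`exists_monic_graded_of_isIntegral` (`IntegralOverH.isIntegral_of_mem_univElimOne` supplies integrality of `G` over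
`H_{F_b}`). [cite: Villamayor2007, Def. 1.42 (1.42.4) p0014 L56–L60] -/
theorem isIntegral_monomial_specialize (a : Fin b → S) {G : MvPolynomial (Fin b) k} {r : ℕ}
    (hG : G ∈ univElimPiece (Fin b) k (fun _ : Fin b => ()) r) :
    IsIntegral (hElimAlgebra k a)
      (Polynomial.monomial r (specialize k a ⟨G, univElimOne_le_symmetricSubalgebra hG.1⟩)) := by
  obtain ⟨Q, hQmonic, hQc, hQhom, hQG⟩ :=
    exists_monic_graded_of_isIntegral (isIntegral_of_mem_univElimOne hG.1) hG.2
  set m := Q.natDegree with hm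
  set h : S := specialize k a ⟨G, univElimOne_le_symmetricSubalgebra hG.1⟩ with hh
  -- the specialized coefficients `c_i(a)`
  let c : ℕ → S := fun i => specialize k a ⟨Q.coeff i, hSubalgebra_le_symmetricSubalgebra (hQc i)⟩
  have hcm : c m = 1 := by
    have h1 : (⟨Q.coeff m, hSubalgebra_le_symmetricSubalgebra (hQc m)⟩ : symmetricSubalgebra (Fin b) k) = 1 :=
      Subtype.ext (by rw [hm]; exact hQmonic.coeff_natDegree)
    show specialize k a _ = 1
    rw [h1, map_one]
  have hcmem : ∀ i, Polynomial.monomial (r * (m - i)) (c i) ∈ hElimAlgebra k a := fun i =>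
    monomial_mem_reesOfFamily (Ideal.subset_span ⟨Q.coeff i, hQc i, hQhom i, rfl⟩)
  -- the relation `Σ c_i(a) h^i = 0`
  have hrel : ∑ i ∈ Finset.range (m + 1), c i * h ^ i = 0 := by
    have hsum : (∑ i ∈ Finset.range (m + 1),
        (⟨Q.coeff i, hSubalgebra_le_symmetricSubalgebra (hQc i)⟩ : symmetricSubalgebra (Fin b) k) *
          ⟨G, univElimOne_le_symmetricSubalgebra hG.1⟩ ^ i) = 0 := by
      apply Subtype.ext
      rw [Subalgebra.coe_zero, ← hQG, Polynomial.eval_eq_sum_range, ← hm]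
      simp
    have h2 := congrArg (specialize k a) hsum
    rw [map_sum, map_zero] at h2
    simpa only [map_mul, map_pow] using h2
  -- the monic polynomial over `S[W]`
  let p : S[X][X] := ∑ i ∈ Finset.range (m + 1),
    Polynomial.monomial i (Polynomial.monomial (r * (m - i)) (c i))
  have hpc : ∀ i, p.coeff i = if i ≤ m then Polynomial.monomial (r * (m - i)) (c i) else 0 := by
    intro i
    simp only [p, Polynomial.finsetSum_coeff, Polynomial.coeff_monomial, Finset.sum_ite_eq',
      Finset.mem_range, Nat.lt_succ_iff]
  have hpm : p.coeff m = 1 := by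
    rw [hpc, if_pos le_rfl, Nat.sub_self, mul_zero, hcm, Polynomial.monomial_zero_left, map_one]
  have hple : p.natDegree ≤ m := by
    rw [Polynomial.natDegree_le_iff_coeff_eq_zero]
    intro N hN
    rw [hpc, if_neg (by omega)]
  have hpmonic : p.Monic := by
    nontriviality S
    have hpdeg : p.natDegree = m :=
      Polynomial.natDegree_eq_of_le_of_coeff_ne_zero hple (by rw [hpm]; exact one_ne_zero)
    rw [Polynomial.Monic, Polynomial.leadingCoeff, hpdeg, hpm]
  refine isIntegral_of_monic_of_coeff_mem (hElimAlgebra k a) hpmonic (fun i => ?_) ?_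
  · rw [hpc]
    split_ifs
    · exact hcmem i
    · exact zero_mem _
  · -- `p(h W^r) = (Σ c_i(a) h^i) W^{rm} = 0`
    rw [Polynomial.eval_eq_sum_range' (lt_of_le_of_lt hple (Nat.lt_succ_self m))]
    have hterm : ∀ i ∈ Finset.range (m + 1), p.coeff i * Polynomial.monomial r h ^ i =
        Polynomial.monomial (r * m) (c i * h ^ i) := by
      intro i hi
      rw [Finset.mem_range, Nat.lt_succ_iff] at hi
      rw [hpc, if_pos hi, Polynomial.monomial_pow, Polynomial.monomial_mul_monomial, mul_tsub,
        Nat.sub_add_cancel (Nat.mul_le_mul_left r hi)]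
    rw [Finset.sum_congr rfl hterm, ← map_sum, hrel, map_zero]

/-- **(1.42.4), integral form: `R̄_f` is integral over `ℋ_f`** [Villamayor 2007, Def. 1.42 p0014 L56–L60 «The
previous observations show that `ℋ_{f_{c_1},…,f_{c_r}} ⊂ R̄_{f_{c_1},…,f_{c_r}}` and that this ring extension is
finite»], one polynomial: every element of the elimination algebra `R̄_f = ⊕ I_r W^r ⊂ S[W]` (`elimAlgebra k a`) is
integral over the computable subalgebra `ℋ_f` (`hElimAlgebra k a`) — generators by `isIntegral_monomial_specialize`,
then sums, products and `S`-multiples of integral elements (module-finiteness itself is not claimed).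
[cite: Villamayor2007, Def. 1.42 (1.42.4) p0014 L56–L60] -/
theorem isIntegral_of_mem_elimAlgebra (a : Fin b → S) {q : S[X]} (hq : q ∈ elimAlgebra k a) :
    IsIntegral (hElimAlgebra k a) q := by
  have hC : ∀ s : S, IsIntegral (hElimAlgebra k a) (Polynomial.C s : S[X]) := fun s =>
    isIntegral_algebraMap (R := hElimAlgebra k a) (A := S[X])
      (x := ⟨Polynomial.C s, (hElimAlgebra k a).algebraMap_mem s⟩)
  unfold elimAlgebra reesOfFamily at hq
  induction hq using Algebra.adjoin_induction with
  | mem x hx =>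
    obtain ⟨n, c, hc, rfl⟩ := hx
    unfold elimIdeal at hc
    induction hc using Submodule.span_induction with
    | mem x hx =>
      obtain ⟨H, rfl⟩ := hx
      exact isIntegral_monomial_specialize k a H.2
    | zero => rw [map_zero]; exact isIntegral_zero
    | add x y _ _ hx hy => rw [map_add]; exact hx.add hy
    | smul s x _ hx =>
      rw [smul_eq_mul, ← Polynomial.C_mul_monomial]
      exact (hC s).mul hx
  | algebraMap s => exact hC s
  | add x y _ _ hx hy => exact hx.add hy
  | mul x y _ _ hx hy => exact hx.mul hy

/-- `R̄_f ⊆` the integral closure of `ℋ_f` in `S[W]` (set form of `isIntegral_of_mem_elimAlgebra`).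
[cite: Villamayor2007, Def. 1.42 (1.42.4) p0014 L56–L60] -/
theorem elimAlgebra_subset_integralClosure (a : Fin b → S) :
    (elimAlgebra k a : Set S[X]) ⊆ integralClosure (hElimAlgebra k a) S[X] :=
  fun _ hq => isIntegral_of_mem_elimAlgebra k a hq

/-- **`R̄_f` is integral over the algebra of weighted characteristic coefficients** [Bravo–Villamayor 2010, Par. 2.8
p0025 L11–L19 «each endomorphism `L_{f_{n_i}}` has a characteristic polynomial … (2.8.1) … and the elimination algebra
… is generated by these coefficients up to integral closure»; Villamayor 2007 Def. 1.42 (1.42.3)–(1.42.4)], one monic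
polynomial `f = monicOf a` of degree `b`, family `{Δ^e(f)·W^{b−e} ; 1 ≤ e ≤ b − 1}`: every element of `R̄_f` is
integral over `S[ψ_{Δ^e f, n}·W^{(b−n)(b−e)}]` (`mulCharpolyReesOfFamily`; = `ℋ_f` by
`hElimAlgebra_eq_mulCharpolyReesOfFamily`). [cite: BravoVillamayor2010, Par. 2.8 (2.8.1)] -/
theorem isIntegral_mulCharpolyReesOfFamily_of_mem_elimAlgebra (a : Fin b → S) {q : S[X]}
    (hq : q ∈ elimAlgebra k a) :
    IsIntegral (mulCharpolyReesOfFamily (monicOf a) (monicOf_monic a)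
      {gn | ∃ e : ℕ, 1 ≤ e ∧ e + 1 ≤ b ∧ gn = (Polynomial.hasseDeriv e (monicOf a), b - e)}) q := by
  rw [← hElimAlgebra_eq_mulCharpolyReesOfFamily k a]
  exact isIntegral_of_mem_elimAlgebra k a hq

/-- Set form: `R̄_f ⊆` the integral closure in `S[W]` of the coefficient algebra `S[ψ_{Δ^e f, n}·W^{(b−n)(b−e)}]`.
[cite: BravoVillamayor2010, Par. 2.8 (2.8.1)] -/
theorem elimAlgebra_subset_integralClosure_mulCharpolyReesOfFamily (a : Fin b → S) :
    (elimAlgebra k a : Set S[X]) ⊆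
      integralClosure (mulCharpolyReesOfFamily (monicOf a) (monicOf_monic a)
        {gn | ∃ e : ℕ, 1 ≤ e ∧ e + 1 ≤ b ∧ gn = (Polynomial.hasseDeriv e (monicOf a), b - e)}) S[X] :=
  fun _ hq => isIntegral_mulCharpolyReesOfFamily_of_mem_elimAlgebra k a hq

end Specialized

end Literature.AlgebraicGeometry.Villamayor2007

end
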